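import Literature.Geometry.Riemannian.LiQingShiPinchingProofs
import Literature.Geometry.Riemannian.ChangGurskyYangProofs
import Literature.Geometry.Lorentzian.MetricNormSq
import HarnessLib

/-!
# Gursky–Viaclovsky 2003, Prop. 1 (ii): the first Newton transformation is positive definite on
# the cone `Γ₂⁺`, hence the linearised `σ₂`-equation is elliptic for `t ≤ 1`

Support file (everything PROVED; no definition, no named fact) for the named fact
`Literature.Geometry.Riemannian.gurskyViaclovsky_pathOpen_weighted_four`
(`GurskyViaclovskyOpenness.lean`). Gursky–Viaclovsky, *A fully nonlinear equation on
four-manifolds with positive scalar curvature*, J. Differential Geom. 63 (2003), §2: with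
`Γ₂⁺ = {σ₂ > 0} ∩ {σ₁ > 0}` (Def. 1), the first Newton transformation `T₁(A) = σ₁(A)·I − A` and
`L^t(A) = T₁(A) + ((1−t)/2) σ₁(T₁(A))·I` (Def. 2), Prop. 1 (ii) reads: "If the eigenvalues of `A`
are in `Γ₂⁺`, then `T₁(A)` is positive definite. Consequently, for `t ≤ 1`, `L^t(A)` is also
positive definite" (proof there: "standard, and may be found in [CNSIII] and [Garding]"). This
is the pointwise algebra that makes the linearisation `𝓛^t` of the path equation elliptic in
Prop. 2 ("For `t ≤ 1`, Proposition (ellsumm) implies that `L^t(g⁻¹A^t_u)` is positive definite,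
so `𝓛^t` is elliptic"), and that gives "the `C²` estimate implies uniform ellipticity" in Prop. 6.

Here `A` is any bilinear form `T` on a tangent space `T_x M` carrying a positive definite `g_x`,
`σ₁ = tr_g T` (`PseudoRiemannianMetric.trace`) and `2σ₂ = σ₁² − |T|²_g` (`|T|²_g = normSq`, the
normalisation of `sigma2WeylSchouten = ½((ΣA_aa)² − ΣA_ab²)` in `ChangGurskyYangProofs.lean`), so
"`A ∈ Γ₂⁺`" is `0 < tr_g T ∧ |T|²_g < (tr_g T)²`. The proof is shorter than the eigenvalue one:
in a `g_x`-orthonormal frame through the unit vector `u`, `|T|² ≥ T(u,u)²`, so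
`0 < 2σ₂ ≤ σ₁² − T(u,u)²` forces `|T(u,u)| < σ₁`:

* `abs_lt_of_sq_le_of_lt_sq` — the real-number step;
* `sq_apply_self_le_normSq` — `T(e_i, e_i)² ≤ |T|²_g` in an orthonormal frame;
* `abs_apply_self_lt_trace_mul` — **`|T(v,v)| < σ₁(T)·g(v,v)`** for `v ≠ 0` on `Γ₂⁺`; in
  particular `apply_self_lt_trace_mul`: **`T₁(T)(v,v) = σ₁ g(v,v) − T(v,v) > 0`** (Prop. 1 (ii),
  first clause) and `neg_trace_mul_lt_apply_self`: `T + σ₁ g > 0`;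
* `apply_self_lt_Lt_mul` — **`L^t(T)(v,v) = T₁(T)(v,v) + ((1−t)/2)·3σ₁·g(v,v) > 0` for `t ≤ 1`**
  in dimension four, `σ₁(T₁(T)) = 3σ₁(T)` (Prop. 1 (ii), second clause).

## References

* M. J. Gursky, J. A. Viaclovsky, J. Differential Geom. 63 (2003) 131–154, arXiv:math/0301350,
  §2, Def. 1–2, Prop. 1 (ii), proof of Prop. 2. [GurskyViaclovsky2003]
* L. Caffarelli, L. Nirenberg, J. Spruck, *The Dirichlet problem for nonlinear second order
  elliptic equations, III*, Acta Math. 155 (1985) (the source [CNSIII] cited there).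
-/

noncomputable section

open Finset Module

namespace Literature.Geometry.Riemannian

open Lorentzian Lorentzian.PseudoRiemannianMetric
open scoped Manifold ContDiff

/-! ### The real-number step -/

/-- If `a² ≤ N < s²` and `0 < s` then `|a| < s`. [folklore] -/
theorem abs_lt_of_sq_le_of_lt_sq {a N s : ℝ} (haN : a ^ 2 ≤ N) (hNs : N < s ^ 2) (hs : 0 < s) :
    |a| < s :=
  abs_lt_of_sq_lt_sq (lt_of_le_of_lt haN hNs) hs.le

/-! ### Frames -/

section Frame

variable {E : Type*} [NormedAddCommGroup E] [NormedSpace ℝ E] {H : Type*} [TopologicalSpace H]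
  {I : ModelWithCorners ℝ E H} {M : Type*} [TopologicalSpace M] [ChartedSpace H M]
  [IsManifold I ∞ M] {n : ℕ∞ω} [FiniteDimensional ℝ E]
  (g : PseudoRiemannianMetric I n E (TangentSpace I : M → Type _)) {x : M}

/-- **`T(eᵢ, eᵢ)² ≤ |T|²_g` in a `g_x`-orthonormal frame** (`|T|²_g = Σ_a Σ_b T(e_b, e_a)²`,
`normSq_eq_sum_sq`, is a sum of squares containing the diagonal term). [folklore] -/
theorem sq_apply_self_le_normSq {m : ℕ} (hm : finrank ℝ E = m) {e : Fin m → TangentSpace I x}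
    (he : g.IsOrthonormalFrame x e) (T : LinearMap.BilinForm ℝ (TangentSpace I x)) (i : Fin m) :
    T (e i) (e i) ^ 2 ≤ g.normSq x T := by
  classical
  set b := he.toBasis ((Fintype.card_fin m).trans hm.symm) with hb
  have hbe : ⇑b = e := he.coe_toBasis _
  have hbo : (g.toBilinForm x).IsOrthoᵢ b :=
    LinearMap.BilinForm.iIsOrtho_def.2 fun a c hac ↦ by simpa [hbe] using he.2 a c hac
  have hb1 : ∀ a, g.val x (b a) (b a) = 1 := fun a ↦ by rw [hbe]; exact he.1 a
  rw [g.normSq_eq_sum_sq x b hbo (fun a ↦ by rw [hb1 a]; exact one_ne_zero) T]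
  simp only [hbe, he.1, mul_one, div_one]
  calc T (e i) (e i) ^ 2 ≤ ∑ c, T (e c) (e i) ^ 2 :=
        Finset.single_le_sum (f := fun c ↦ T (e c) (e i) ^ 2) (fun c _ ↦ sq_nonneg _)
          (Finset.mem_univ i)
    _ ≤ ∑ a, ∑ c, T (e c) (e a) ^ 2 :=
        Finset.single_le_sum (f := fun a ↦ ∑ c, T (e c) (e a) ^ 2)
          (fun a _ ↦ Finset.sum_nonneg fun c _ ↦ sq_nonneg _) (Finset.mem_univ i)

/-- **Gursky–Viaclovsky 2003, Prop. 1 (ii), two-sided form: `|A(v,v)| < σ₁(A)·g(v,v)` on `Γ₂⁺`.**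
For a bilinear form `T` on `T_x M` with `g_x` positive definite, `σ₁ = tr_g T > 0` and
`|T|²_g < σ₁²` (i.e. `σ₂ = ½(σ₁² − |T|²) > 0`), every `v ≠ 0` satisfies
`|T(v,v)| < tr_g T · g(v,v)`. Proof: normalise `v` to `u`, put `u` in an orthonormal frame
(`exists_isOrthonormalFrame_extend`), `T(u,u)² ≤ |T|² < σ₁²` (`sq_apply_self_le_normSq`).
[cite: GurskyViaclovsky2003, §2, Prop. 1 (ii)] -/
theorem abs_apply_self_lt_trace_mul (hpos : ∀ v : TangentSpace I x, v ≠ 0 → 0 < g.val x v v)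
    (T : LinearMap.BilinForm ℝ (TangentSpace I x)) (htr : 0 < g.trace x T)
    (hσ : g.normSq x T < g.trace x T ^ 2) {v : TangentSpace I x} (hv : v ≠ 0) :
    |T v v| < g.trace x T * g.val x v v := by
  classical
  -- the dimension is positive since `v ≠ 0`
  haveI : FiniteDimensional ℝ (TangentSpace I x) := ‹FiniteDimensional ℝ E›
  obtain ⟨k, hk⟩ : ∃ k : ℕ, finrank ℝ E = k + 1 := by
    have hpos' : 0 < finrank ℝ (TangentSpace I x) := finrank_pos_iff_exists_ne_zero.2 ⟨v, hv⟩
    exact ⟨finrank ℝ E - 1, (Nat.sub_add_cancel hpos').symm⟩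
  -- normalise `v`
  set c := g.val x v v with hc
  have hcpos : 0 < c := hpos v hv
  set r := Real.sqrt c with hr
  have hrpos : 0 < r := Real.sqrt_pos.2 hcpos
  have hrr : r * r = c := Real.mul_self_sqrt hcpos.le
  set u : TangentSpace I x := r⁻¹ • v with hu
  have hTuu : T u u = (r⁻¹ * r⁻¹) * T v v := by
    simp only [hu, map_smul, LinearMap.smul_apply, smul_eq_mul]
    ring
  have hguu : g.val x u u = 1 := by
    have h1 : g.val x u u = r⁻¹ * r⁻¹ * c := by
      simp only [hu, map_smul, FunLike.coe_smul, Pi.smul_apply, smul_eq_mul, hc]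
      ring
    rw [h1, ← hrr]
    field_simp
  -- an orthonormal frame through `u`
  obtain ⟨e, he, he0⟩ := g.exists_isOrthonormalFrame_extend hpos hk (fun _ ↦ u) {0}
    (fun i _ ↦ hguu) (fun i hi j hj hij ↦ (hij (by simp_all)).elim)
  have he0' : e 0 = u := he0 0 rfl
  -- `T(u,u)² ≤ |T|² < σ₁²`
  have hsq : T u u ^ 2 ≤ g.normSq x T := by
    rw [← he0']
    exact sq_apply_self_le_normSq g hk he T 0
  have habs : |T u u| < g.trace x T := abs_lt_of_sq_le_of_lt_sq hsq hσ htr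
  -- scale back
  have hscale : T v v = c * T u u := by
    rw [hTuu, ← hrr]
    field_simp
  rw [hscale, abs_mul, abs_of_pos hcpos, mul_comm (g.trace x T) c]
  exact mul_lt_mul_of_pos_left habs hcpos

/-- **Gursky–Viaclovsky 2003, Prop. 1 (ii): the first Newton transformation `T₁(A) = σ₁(A)g − A`
is positive definite on `Γ₂⁺`** — `A(v,v) < tr_g A · g(v,v)` for `v ≠ 0` whenever `tr_g A > 0`
and `|A|²_g < (tr_g A)²`. [cite: GurskyViaclovsky2003, §2, Prop. 1 (ii)] -/
theorem apply_self_lt_trace_mul (hpos : ∀ v : TangentSpace I x, v ≠ 0 → 0 < g.val x v v)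
    (T : LinearMap.BilinForm ℝ (TangentSpace I x)) (htr : 0 < g.trace x T)
    (hσ : g.normSq x T < g.trace x T ^ 2) {v : TangentSpace I x} (hv : v ≠ 0) :
    T v v < g.trace x T * g.val x v v :=
  (le_abs_self _).trans_lt (abs_apply_self_lt_trace_mul g hpos T htr hσ hv)

/-- The mirror clause: `A + σ₁(A) g` is positive definite on `Γ₂⁺` (`−σ₁ g(v,v) < A(v,v)`); with
`T₁ > 0` this is the pair of Ricci inequalities (Ricineq) of Gursky–Viaclovsky 2003, Thm. 1, in
their crudest form. [cite: GurskyViaclovsky2003, §2, Prop. 1 (ii)] -/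
theorem neg_trace_mul_lt_apply_self (hpos : ∀ v : TangentSpace I x, v ≠ 0 → 0 < g.val x v v)
    (T : LinearMap.BilinForm ℝ (TangentSpace I x)) (htr : 0 < g.trace x T)
    (hσ : g.normSq x T < g.trace x T ^ 2) {v : TangentSpace I x} (hv : v ≠ 0) :
    -(g.trace x T * g.val x v v) < T v v :=
  (abs_lt.1 (abs_apply_self_lt_trace_mul g hpos T htr hσ hv)).1

/-- **Gursky–Viaclovsky 2003, Prop. 1 (ii), second clause, in dimension four: `L^t(A)` is
positive definite for `t ≤ 1` on `Γ₂⁺`.** With `L^t(A) = T₁(A) + ((1−t)/2)σ₁(T₁(A))·I` (Def. 2)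
and `σ₁(T₁(A)) = 4σ₁(A) − σ₁(A) = 3σ₁(A)` in dimension `4`, the form
`L^t(A)(v,v) = (1 + 3(1−t)/2)·σ₁(A)·g(v,v) − A(v,v)` is positive for `v ≠ 0`: the added term is
nonnegative for `t ≤ 1`. This is the ellipticity of the linearised path equation `𝓛^t`
(proof of Prop. 2). [cite: GurskyViaclovsky2003, §2, Prop. 1 (ii) and proof of Prop. 2] -/
theorem apply_self_lt_Lt_mul (hpos : ∀ v : TangentSpace I x, v ≠ 0 → 0 < g.val x v v)
    (T : LinearMap.BilinForm ℝ (TangentSpace I x)) (htr : 0 < g.trace x T)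
    (hσ : g.normSq x T < g.trace x T ^ 2) {t : ℝ} (ht : t ≤ 1) {v : TangentSpace I x}
    (hv : v ≠ 0) :
    T v v < (1 + 3 * (1 - t) / 2) * g.trace x T * g.val x v v := by
  have h1 := apply_self_lt_trace_mul g hpos T htr hσ hv
  have h2 : 0 ≤ 3 * (1 - t) / 2 * (g.trace x T * g.val x v v) :=
    mul_nonneg (by linarith) (mul_pos htr (hpos v hv)).le
  nlinarith

end Frame

end Literature.Geometry.Riemannian

end
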